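import Literature.Geometry.GeometricMeasureTheory.LevelSetChartCurrent
import Literature.Geometry.GeometricMeasureTheory.CurrentsSlicing
import HarnessLib

/-!
# Slicing a flat chart current with an `L¹` integer density by the level sets of a smooth function

Support file for the boundary-rectifiability theorem [Federer1969, 4.2.16 (2)]. Let
`Ψ : ℝ^{m+1} ⊇ O₀ → V` be a smooth injective immersion with a Lipschitz left inverse, `θ` an
**integrable integer-valued density** on a measurable `C`, and `R = Ψ_# (θ e₀ ∧ ⋯ ∧ e_m) ⌞ C`
the current `R(ω) = ∫_C θ(u) ω(Ψ u)(DΨ(u) e₀, …, DΨ(u) e_m) du`. For a smooth `f` on `V` with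
`d(f ∘ Ψ)(k₁) ≠ 0` we prove, on a neighbourhood `O₁` of `k₁`, the chart-level case of Federer's
slicing formula for rectifiable currents [Federer1969, 4.3.8, via 3.2.22] with a VARYING density:
for every test form `φ` and almost every level `s`,

  `R(d gₙ ∧ φ) ⟶ [Ψ(C ∩ {f ∘ Ψ = s}), θ_s, ξ_s](φ)`  (`gₙ = S((n+1)(f − s))`, `sliceApprox`),

where the right side is the current of integration over the image of the level set, parametrised
bi-Lipschitzly over `ℝ^m` after straightening `f ∘ Ψ` (`exists_straighten`), with the integer
density `± θ` transported along (`isRectifiableData_image_density`); these level currents are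
rectifiable for almost every `s` (`exists_sliceData_chart`, and `exists_sliceData_compact` on a
compact set of regular points). With `T ⌞ d gₙ → ⟨T, f, s+⟩`
(`Current.IsRepresentable.tendsto_wedgeD_slice`) this computes the slices of currents carried by
flat (or smoothly parametrised) pieces with `L¹` integer multiplicities.

The proof: `(d gₙ ∧ φ)(Ψ u)(DΨ e) = ρₙ(G u) · Λ_φ(u)` with `G = f ∘ Ψ` and the kernel
`ρₙ = (S((n+1)(· − s)))'` (chain rule); straightening `G ∘ Φ = uᵢ` and the change of variables
`u = Φ(w)` turn `det DΦ · Λ_φ ∘ Φ` into `(−1)ⁱ φ(F w)(DF(w) e ∘ succAbove i)`, `F = Ψ ∘ Φ`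
(a top-degree form sees `DΦ` through its determinant, `apply_comp_basis_eq_det_mul`); Fubini in
the straightened coordinates gives `R(d gₙ ∧ φ) = ∫ ρₙ(t) Γ_φ(t) dt` with `Γ_φ ∈ L¹(ℝ)` the fibre
integrals, and `∫ ρₙ Γ_φ → Γ_φ(s)` at every Lebesgue point `s` of `Γ_φ` (the kernels `ρₙ ≥ 0` are
supported in `[s, s + 1/(n+1)]`, bounded by `M_S (n+1)`, of integral one; Lebesgue's
differentiation theorem `IsUnifLocDoublingMeasure.ae_tendsto_average_norm_sub`). Finally
`Γ_φ(s) = [data_s](φ)` by `currentOfIntegration_image_density_apply`.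

Theorems only; no definitions, no named facts.

## References

* H. Federer, *Geometric Measure Theory*, Springer 1969, 2.9.8, 3.2.12, 3.2.22, 4.1.28, 4.2.1,
  4.3.1, 4.3.4, 4.3.8 [Federer1969].
* M. Spivak, *Calculus on Manifolds*, Benjamin 1965, Thm. 3-13, 5-5 [Spivak1965].
-/

noncomputable section

open scoped Topology ContDiff NNReal ENNReal
open MeasureTheory Set Function Filter Metric WithLp TopologicalSpace

namespace Literature.Geometry.GeometricMeasureTheory

-- Nested operator-norm instances on (duals of) `V [⋀^Fin n]→L[ℝ] ℝ`.
set_option maxSynthPendingDepth 2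

/-! ### The one-dimensional kernels `ρ = (S(h⁻¹(· − s)))'` and their Lebesgue points -/

section Kernel

/-- The derivative of the one-dimensional slice approximant `t ↦ S(h⁻¹(t − s))`:
`h⁻¹ S'(h⁻¹ (t − s))`. [folklore] -/
private theorem hasDerivAt_sliceApprox_id (s h t : ℝ) :
    HasDerivAt (sliceApprox id s h) (h⁻¹ * deriv Real.smoothTransition (h⁻¹ * (t - s))) t := by
  have h1 : HasDerivAt (fun t : ℝ => h⁻¹ * (id t - s)) h⁻¹ t := by
    have := ((hasDerivAt_id t).sub_const s).const_mul h⁻¹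
    simpa only [mul_one] using this
  have h2 : HasDerivAt Real.smoothTransition (deriv Real.smoothTransition (h⁻¹ * (id t - s)))
      (h⁻¹ * (id t - s)) :=
    ((contDiff_smoothTransition.differentiable (by simp)) _).hasDerivAt
  have h3 := h2.comp t h1
  have h4 : HasDerivAt (sliceApprox id s h) (deriv Real.smoothTransition (h⁻¹ * (id t - s)) * h⁻¹) t :=
    h3
  refine h4.congr_deriv ?_
  simp only [id]; ring

/-- `deriv (t ↦ S(h⁻¹(t − s))) = h⁻¹ S'(h⁻¹(t − s))`. [folklore] -/
private theorem deriv_sliceApprox_id (s h t : ℝ) :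
    deriv (sliceApprox id s h) t = h⁻¹ * deriv Real.smoothTransition (h⁻¹ * (t - s)) :=
  (hasDerivAt_sliceApprox_id s h t).deriv

/-- The kernel `(S(h⁻¹(· − s)))'` is continuous. [folklore] -/
private theorem continuous_deriv_sliceApprox_id (s h : ℝ) : Continuous (deriv (sliceApprox id s h)) :=
  (contDiff_sliceApprox (f := (id : ℝ → ℝ)) contDiff_id s h).continuous_deriv (by simp)

/-- **The kernel is supported in `[s, s + h]` and bounded by `M_S / h`**:
`|(S(h⁻¹(· − s)))'(t)| ≤ (M_S/h) 1_{[s, s+h]}(t)`. [cite: Federer1969, 4.2.1] -/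
theorem abs_deriv_sliceApprox_id_le {s h : ℝ} (hh : 0 < h) (t : ℝ) :
    |deriv (sliceApprox id s h) t| ≤
      smoothTransitionDerivBound / h * (Icc s (s + h)).indicator 1 t := by
  have h1 := norm_fderiv_sliceApprox_le (f := (id : ℝ → ℝ)) contDiff_id (r := s) hh t
  rw [← norm_deriv_eq_norm_fderiv, Real.norm_eq_abs] at h1
  refine h1.trans ?_
  have hid : ‖fderiv ℝ (id : ℝ → ℝ) t‖ ≤ 1 := by
    rw [fderiv_id]; exact ContinuousLinearMap.norm_id_le
  have hpre : ((id : ℝ → ℝ) ⁻¹' Icc s (s + h)).indicator (1 : ℝ → ℝ) t =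
      (Icc s (s + h)).indicator 1 t := rfl
  rw [hpre]
  have hM : 0 ≤ smoothTransitionDerivBound / h := div_nonneg smoothTransitionDerivBound_nonneg hh.le
  have hind : 0 ≤ (Icc s (s + h)).indicator (1 : ℝ → ℝ) t :=
    indicator_nonneg (fun _ _ => zero_le_one) _
  calc smoothTransitionDerivBound / h * ‖fderiv ℝ (id : ℝ → ℝ) t‖ * (Icc s (s + h)).indicator 1 t
      ≤ smoothTransitionDerivBound / h * 1 * (Icc s (s + h)).indicator 1 t := by gcongr
    _ = _ := by rw [mul_one]

/-- The kernel vanishes off `[s, s + h]`. [folklore] -/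
private theorem deriv_sliceApprox_id_eq_zero {s h : ℝ} (hh : 0 < h) {t : ℝ} (ht : t ∉ Icc s (s + h)) :
    deriv (sliceApprox id s h) t = 0 := by
  have := abs_deriv_sliceApprox_id_le (s := s) hh t
  rw [indicator_of_notMem ht, mul_zero] at this
  exact abs_nonpos_iff.1 this

/-- **The kernel has integral one**: `∫ (S(h⁻¹(· − s)))' = S(1) − S(0) = 1`. [folklore] -/
private theorem integral_deriv_sliceApprox_id {s h : ℝ} (hh : 0 < h) :
    ∫ t, deriv (sliceApprox id s h) t = 1 := by
  have hsh : s ≤ s + h := by linarith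
  rw [← setIntegral_eq_integral_of_forall_compl_eq_zero (s := Icc s (s + h))
      (fun t ht => deriv_sliceApprox_id_eq_zero hh ht),
    integral_Icc_eq_integral_Ioc, ← intervalIntegral.integral_of_le hsh,
    intervalIntegral.integral_eq_sub_of_hasDerivAt (f := sliceApprox id s h)
      (fun x _ => (hasDerivAt_sliceApprox_id s h x).differentiableAt.hasDerivAt)
      ((continuous_deriv_sliceApprox_id s h).intervalIntegrable _ _),
    sliceApprox_eq_one hh (by simp), sliceApprox_eq_zero hh (by simp)]
  norm_num

/-- The kernel against a constant: `∫ (S(h⁻¹(· − s)))'(t) c dt = c`. [folklore] -/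
private theorem integral_deriv_sliceApprox_id_mul_const {s h : ℝ} (hh : 0 < h) (c : ℝ) :
    ∫ t, deriv (sliceApprox id s h) t * c = c := by
  rw [integral_mul_const, integral_deriv_sliceApprox_id hh, one_mul]

/-- **Lebesgue points of the level integrand**: for an integrable `Γ : ℝ → ℝ` and almost every
level `s`, `∫ (S(hₙ⁻¹(t − s)))' Γ(t) dt → Γ(s)` along `hₙ = 1/(n+1)` — the kernels are supported in
`[s, s + hₙ] ⊆ 𝐁(s, hₙ)`, bounded by `M_S/hₙ` and have integral one, so the error is at most
`2 M_S ⨍_{𝐁(s,hₙ)} |Γ − Γ(s)| → 0` at every Lebesgue point (Lebesgue's differentiation theorem).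
[cite: Federer1969, 2.9.8, 4.3.4] -/
theorem ae_tendsto_integral_deriv_sliceApprox_mul {Γ : ℝ → ℝ} (hΓ : Integrable Γ) :
    ∀ᵐ s : ℝ, Tendsto (fun n : ℕ => ∫ t, deriv (sliceApprox id s (1 / ((n : ℝ) + 1))) t * Γ t)
      atTop (𝓝 (Γ s)) := by
  set hseq : ℕ → ℝ := fun n => 1 / ((n : ℝ) + 1) with hseq_def
  have hpos : ∀ n, 0 < hseq n := fun n => by positivity
  have hlim : Tendsto hseq atTop (𝓝[>] 0) :=
    tendsto_nhdsWithin_iff.2 ⟨tendsto_one_div_add_atTop_nhds_zero_nat, Eventually.of_forall hpos⟩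
  have hleb := IsUnifLocDoublingMeasure.ae_tendsto_average_norm_sub (volume : Measure ℝ)
    hΓ.locallyIntegrable 1
  filter_upwards [hleb] with s hs
  have hA := hs (fun _ : ℕ => s) hseq hlim (Eventually.of_forall fun n => by
    rw [one_mul]; exact mem_closedBall_self (hpos n).le)
  set M := smoothTransitionDerivBound with hMdef
  have hM0 : 0 ≤ M := smoothTransitionDerivBound_nonneg
  -- the error bound `|∫ kₙ Γ − Γ s| ≤ 2 M ⨍_{𝐁(s,hₙ)} |Γ − Γ s|`
  have hbound : ∀ n, ‖(∫ t, deriv (sliceApprox id s (hseq n)) t * Γ t) - Γ s‖ ≤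
      2 * M * ⨍ t in closedBall s (hseq n), ‖Γ t - Γ s‖ := by
    intro n
    set k := deriv (sliceApprox id s (hseq n)) with hk
    have hh := hpos n
    have hkc : Continuous k := continuous_deriv_sliceApprox_id s (hseq n)
    have hkb : ∀ t, |k t| ≤ M / hseq n := fun t =>
      (abs_deriv_sliceApprox_id_le (s := s) hh t).trans (by
        have : (Icc s (s + hseq n)).indicator (1 : ℝ → ℝ) t ≤ 1 :=
          indicator_le_self' (fun _ _ => zero_le_one) t
        have hMh : 0 ≤ M / hseq n := div_nonneg hM0 hh.le
        nlinarith)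
    have hk0 : ∀ t, t ∉ closedBall s (hseq n) → k t = 0 := fun t ht =>
      deriv_sliceApprox_id_eq_zero hh fun h' => ht (by
        rw [mem_closedBall, Real.dist_eq, abs_le]; constructor <;> linarith [h'.1, h'.2])
    have hint : Integrable (fun t => k t * Γ t) :=
      hΓ.bdd_mul hkc.aestronglyMeasurable (Eventually.of_forall fun t => by
        rw [Real.norm_eq_abs]; exact hkb t)
    have hintc : Integrable (fun t => k t * Γ s) :=
      (hkc.integrable_of_hasCompactSupport (HasCompactSupport.intro isCompact_Icc
        fun t ht => deriv_sliceApprox_id_eq_zero hh ht)).mul_const _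
    have h1 : (∫ t, k t * Γ t) - Γ s = ∫ t in closedBall s (hseq n), k t * (Γ t - Γ s) := by
      conv_lhs => rw [← integral_deriv_sliceApprox_id_mul_const (s := s) hh (Γ s)]
      rw [← integral_sub hint hintc, ← setIntegral_eq_integral_of_forall_compl_eq_zero
        (s := closedBall s (hseq n)) (fun t ht => by rw [hk0 t ht]; ring)]
      refine setIntegral_congr_fun measurableSet_closedBall fun t _ => ?_
      ring
    rw [h1]
    have hvol : volume (closedBall s (hseq n)) ≠ ⊤ := by
      rw [Real.volume_closedBall]; exact ENNReal.ofReal_ne_top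
    have hIs : IntegrableOn (fun t => ‖Γ t - Γ s‖) (closedBall s (hseq n)) :=
      (hΓ.integrableOn.sub (integrableOn_const hvol)).norm
    have h2 : ‖∫ t in closedBall s (hseq n), k t * (Γ t - Γ s)‖ ≤
        ∫ t in closedBall s (hseq n), M / hseq n * ‖Γ t - Γ s‖ := by
      refine norm_integral_le_of_norm_le (hIs.const_mul _) (Eventually.of_forall fun t => ?_)
      rw [norm_mul, Real.norm_eq_abs]
      exact mul_le_mul_of_nonneg_right (hkb t) (norm_nonneg _)
    refine h2.trans (le_of_eq ?_)
    rw [integral_const_mul, setAverage_eq, smul_eq_mul, Measure.real,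
      Real.volume_closedBall, ENNReal.toReal_ofReal (by positivity)]
    field_simp
  -- conclusion
  rw [tendsto_iff_norm_sub_tendsto_zero]
  refine squeeze_zero_norm (a := fun n => 2 * M * ⨍ t in closedBall s (hseq n), ‖Γ t - Γ s‖)
    (fun n => ?_) ?_
  · rw [Real.norm_eq_abs, abs_of_nonneg (norm_nonneg _)]; exact hbound n
  · have := hA.const_mul (2 * M)
    rw [mul_zero] at this
    exact this

end Kernel


/-! ### Pointwise algebra: `d g ∧ φ` through a chart, and the determinant identity -/

section Algebra

variable {E : Type*} [NormedAddCommGroup E] [NormedSpace ℝ E] {Ω : Opens E} {m : ℕ}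

/-- `(dg ∧ φ)(y)(w₀, …, w_m) = Σ_l (−1)^l Dg(y)(w_l) · φ(y)(w ∘ succAbove l)` (the shuffle formula
for the exterior product of a `1`-covector with an `m`-covector). [cite: Federer1969, 1.4.2, 4.1.6] -/
theorem TestForm.wedgeD_apply_apply {g : E → ℝ} (hg : ContDiff ℝ ∞ g) (φ : TestForm Ω m) (y : E)
    (w : Fin (m + 1) → E) :
    TestForm.wedgeD hg φ y w =
      ∑ l : Fin (m + 1), (-1 : ℝ) ^ (l : ℕ) * (fderiv ℝ g y (w l) * φ y (l.removeNth w)) := by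
  rw [TestForm.wedgeD_apply, ContinuousAlternatingMap.alternatizeUncurryFin_apply]
  refine Finset.sum_congr rfl fun l _ => ?_
  rw [ContinuousLinearMap.smulRight_apply, ContinuousAlternatingMap.smul_apply]
  simp only [zsmul_eq_mul, smul_eq_mul, Int.cast_pow, Int.cast_neg, Int.cast_one]

/-- **Chain rule for the slice approximants**: `D(S(h⁻¹(f − s)))(y) = (S(h⁻¹(· − s)))'(f y) · Df(y)`
(`D(γ ∘ f) = (γ' ∘ f) Df` for the approximants `γ ∘ f` of `1_{f > s}`). [cite: Federer1969, 4.2.1] -/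
theorem fderiv_sliceApprox_eq_deriv_smul {f : E → ℝ} {y : E} (hf : DifferentiableAt ℝ f y)
    (s h : ℝ) :
    fderiv ℝ (sliceApprox f s h) y = deriv (sliceApprox id s h) (f y) • fderiv ℝ f y := by
  have h1 : HasDerivAt (sliceApprox id s h) (deriv (sliceApprox id s h) (f y)) (f y) :=
    (hasDerivAt_sliceApprox_id s h (f y)).differentiableAt.hasDerivAt
  have h2 := h1.comp_hasFDerivAt y hf.hasFDerivAt
  have h3 : sliceApprox id s h ∘ f = sliceApprox f s h := funext fun _ => rfl
  rw [h3] at h2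
  exact h2.fderiv

/-- **A top-degree form sees the straightening through its determinant**: if `λ ∘ A = prᵢ`
then `det A · Σ_l (−1)^l λ(e_l) β(e ∘ succAbove l) = (−1)ⁱ β(A e ∘ succAbove i)` for every
`m`-covector `β` on `ℝ^{m+1}` (apply `alternatizeUncurryFin (λ ⊗ β)` to `A e` and expand).
[cite: Federer1969, 1.4.4] -/
theorem det_mul_sum_wedge_eq {i : Fin (m + 1)} (β : (Fin (m + 1) → ℝ) [⋀^Fin m]→L[ℝ] ℝ)
    (lam : (Fin (m + 1) → ℝ) →L[ℝ] ℝ) (A : (Fin (m + 1) → ℝ) →L[ℝ] (Fin (m + 1) → ℝ))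
    (hA : ∀ v, lam (A v) = v i) :
    A.det * ∑ l : Fin (m + 1), (-1 : ℝ) ^ (l : ℕ) *
        (lam (Pi.single l 1) * β (fun j => Pi.single (l.succAbove j) 1)) =
      (-1 : ℝ) ^ (i : ℕ) * β (fun j => A (Pi.single (i.succAbove j) 1)) := by
  set α := ContinuousAlternatingMap.alternatizeUncurryFin (lam.smulRight β) with hα
  have hαv : ∀ v : Fin (m + 1) → (Fin (m + 1) → ℝ),
      α v = ∑ l : Fin (m + 1), (-1 : ℝ) ^ (l : ℕ) * (lam (v l) * β (l.removeNth v)) := fun v => by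
    rw [hα, ContinuousAlternatingMap.alternatizeUncurryFin_apply]
    refine Finset.sum_congr rfl fun l _ => ?_
    rw [ContinuousLinearMap.smulRight_apply, ContinuousAlternatingMap.smul_apply]
    simp only [zsmul_eq_mul, smul_eq_mul, Int.cast_pow, Int.cast_neg, Int.cast_one]
  have h1 : A.det * ∑ l : Fin (m + 1), (-1 : ℝ) ^ (l : ℕ) *
      (lam (Pi.single l 1) * β (fun j => Pi.single (l.succAbove j) 1)) =
      α (fun k => A (Pi.single k 1)) := by
    rw [apply_comp_basis_eq_det_mul α A, hαv]
    rfl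
  rw [h1, hαv, Finset.sum_eq_single i (fun l _ hl => ?_) (fun h => (h (Finset.mem_univ i)).elim)]
  · rw [hA, Pi.single_eq_same, one_mul]
    rfl
  · rw [hA, Pi.single_eq_of_ne (Ne.symm hl), zero_mul, mul_zero]

end Algebra

/-! ### Fubini in a coordinate direction -/

section Fubini

variable {m : ℕ}

/-- Integration over `ℝ^{m+1}` as an iterated integral, first over the hyperplanes `{wᵢ = t}`
parametrised by `y ↦ insᵢ t y`, against a bounded continuous weight `κ(wᵢ)`:
`∫ κ(wᵢ) H(w) dw = ∫ κ(t) (∫ H(insᵢ t y) dy) dt`, and the fibre integrals are integrable in `t`,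
the fibre integrands for a.e. `t` (Fubini–Tonelli through `MeasurableEquiv.piFinSuccAbove`).
[folklore] -/
private theorem integral_mul_apply_eq_integral_integral_insertNth (i : Fin (m + 1))
    {H : (Fin (m + 1) → ℝ) → ℝ} (hH : Integrable H) {κ : ℝ → ℝ} (hκ : Continuous κ) {M : ℝ}
    (hM : ∀ t, ‖κ t‖ ≤ M) :
    (∫ w, κ (w i) * H w = ∫ t, κ t * ∫ y, H (i.insertNth t y)) ∧
      Integrable (fun t => ∫ y, H (i.insertNth t y)) ∧
      ∀ᵐ t, Integrable (fun y : Fin m → ℝ => H (i.insertNth t y)) := by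
  set e := MeasurableEquiv.piFinSuccAbove (fun _ : Fin (m + 1) => ℝ) i with he
  have hmp : MeasurePreserving e volume volume := volume_preserving_piFinSuccAbove _ i
  have hsymm : ∀ p : ℝ × (Fin m → ℝ), e.symm p = i.insertNth p.1 p.2 := fun p => by
    rw [he, MeasurableEquiv.piFinSuccAbove_symm_apply]
    rfl
  have hvol : (volume : Measure (ℝ × (Fin m → ℝ))) = volume.prod volume := rfl
  have hHe : Integrable (fun p : ℝ × (Fin m → ℝ) => H (i.insertNth p.1 p.2))
      ((volume : Measure ℝ).prod volume) := by
    have h1 := (hmp.symm.integrable_comp hH.aestronglyMeasurable).2 hH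
    rw [← hvol]
    refine h1.congr (Eventually.of_forall fun p => ?_)
    simp only [comp_apply, hsymm]
  refine ⟨?_, hHe.integral_prod_left, ?_⟩
  · have h1 : ∫ w, κ (w i) * H w = ∫ p : ℝ × (Fin m → ℝ), κ p.1 * H (i.insertNth p.1 p.2) := by
      rw [← hmp.symm.integral_comp']
      refine integral_congr_ae (Eventually.of_forall fun p => ?_)
      simp only [hsymm, Fin.insertNth_apply_same]
    have hint : Integrable (fun p : ℝ × (Fin m → ℝ) => κ p.1 * H (i.insertNth p.1 p.2))
        ((volume : Measure ℝ).prod volume) :=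
      hHe.bdd_mul (hκ.comp continuous_fst).aestronglyMeasurable
        (Eventually.of_forall fun p => hM p.1)
    rw [h1, hvol, integral_prod _ hint]
    refine integral_congr_ae (Eventually.of_forall fun t => ?_)
    exact integral_const_mul (κ t) _
  · exact hHe.prod_right_ae

end Fubini

/-! ### Plumbing: the linear insertion `y ↦ insᵢ 0 y` -/

section Insert

variable {m : ℕ}

/-- A continuous linear form on `ℝ^{m+1}` vanishing on the coordinate vectors vanishes. [folklore] -/
private theorem exists_single_apply_ne_zero {G' : (Fin (m + 1) → ℝ) →L[ℝ] ℝ} (hG' : G' ≠ 0) :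
    ∃ i : Fin (m + 1), G' (Pi.single i 1) ≠ 0 := by
  by_contra hcon
  push Not at hcon
  refine hG' (ContinuousLinearMap.ext fun w => ?_)
  rw [zero_apply, pi_eq_sum_univ w, map_sum]
  refine Finset.sum_eq_zero fun i _ => ?_
  rw [show (w i • fun j => if i = j then (1 : ℝ) else 0) = w i • (Pi.single i 1 : Fin (m + 1) → ℝ)
    from by ext j; simp [Pi.single_apply, eq_comm], map_smul, hcon i, smul_zero]

/-- **The linear insertion `y ↦ insᵢ 0 y`** as a continuous linear map `L` with
`insᵢ s y = eᵢ s + L y`, `L e'ⱼ = e_{succAbove i j}`, and `L` injective. [folklore] -/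
private theorem exists_insertNth_clm' (i : Fin (m + 1)) :
    ∃ L : (Fin m → ℝ) →L[ℝ] (Fin (m + 1) → ℝ), (∀ y, L y = i.insertNth (0 : ℝ) y) ∧
      (∀ s y, i.insertNth s y = (Pi.single i s : Fin (m + 1) → ℝ) + L y) ∧
      (∀ j, L (Pi.single j 1) = Pi.single (i.succAbove j) 1) ∧ Injective L := by
  have hsmul : ∀ (c : ℝ) (y : Fin m → ℝ), i.insertNth (0 : ℝ) (c • y) = c • i.insertNth (0 : ℝ) y := by
    intro c y
    ext j
    obtain h | ⟨l, h⟩ := Fin.eq_self_or_eq_succAbove i j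
    · rw [h]; simp
    · rw [h]; simp
  set L : (Fin m → ℝ) →L[ℝ] (Fin (m + 1) → ℝ) := LinearMap.toContinuousLinearMap
    { toFun := fun y => i.insertNth (0 : ℝ) y
      map_add' := fun y y' => by simpa using Fin.insertNth_add (α := fun _ => ℝ) i 0 0 y y'
      map_smul' := fun c y => hsmul c y } with hL
  have hLy : ∀ y, L y = i.insertNth (0 : ℝ) y := fun y => rfl
  refine ⟨L, hLy, fun s y => ?_, fun j => ?_, fun y y' h => ?_⟩
  · rw [hLy, ← Fin.insertNth_zero_right, ← Fin.insertNth_add (α := fun _ => ℝ), add_zero, zero_add]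
  · rw [hLy]
    ext l
    obtain h | ⟨l', h⟩ := Fin.eq_self_or_eq_succAbove i l
    · rw [h, Fin.insertNth_apply_same, Pi.single_eq_of_ne (Fin.succAbove_ne i j).symm]
    · rw [h, Fin.insertNth_apply_succAbove]
      by_cases h' : l' = j
      · subst h'; simp
      · rw [Pi.single_eq_of_ne h', Pi.single_eq_of_ne (fun h'' => h' (Fin.succAbove_right_injective h''))]
  · ext j
    have := congrFun h (i.succAbove j)
    simpa [hLy] using this

end Insert

/-! ### The slice data of a chart current with density -/

section Main

variable {V : Type*} [NormedAddCommGroup V] [InnerProductSpace ℝ V] [FiniteDimensional ℝ V]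
  [MeasurableSpace V] [BorelSpace V] {m : ℕ}

set_option maxHeartbeats 800000 in
/-- **Slicing a chart current with an `L¹` integer density by the level sets of a smooth
function.** Let `Ψ` be smooth on an open `O₀ ⊆ ℝ^{m+1}` with injective differentials and a
Lipschitz left inverse `ℓ`, `f` smooth on `V` with `d(f ∘ Ψ)(k₁) ≠ 0`, `k₁ ∈ O₀`. Then there is an
open `O₁`, `k₁ ∈ O₁ ⊆ O₀`, such that for every measurable `C ⊆ O₁` and every integer density `θ`
integrable on `C` there are currents `D_t ∈ 𝒟_m(V)`, rectifiable for a.e. `t` (the currents of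
integration over `Ψ(C ∩ {f ∘ Ψ = t})` with the density `± θ` carried along), such that for every
test form `φ` and almost every level `s`

  `∫_C θ(u) (d gₙ ∧ φ)(Ψ u)(DΨ(u) e₀, …, DΨ(u) e_m) du ⟶ D_s(φ)`, `gₙ = S((n+1)(f − s))`:

the slices `⟨R, f, s+⟩` of `R = ∫_C θ Ψ_#(e₀ ∧ ⋯ ∧ e_m)` are the level currents, for a.e. `s`
(Federer 4.3.8 for a smoothly parametrised piece with summable multiplicity, via the coarea
formula 3.2.22 in the straightened coordinates and Lebesgue points 2.9.8 of the fibre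
integrals). [cite: Federer1969, 4.3.8, 3.2.22, 4.3.1, 2.9.8; Spivak1965, Thm. 5-5] -/
theorem exists_sliceData_chart {O₀ : Set (Fin (m + 1) → ℝ)} (hO₀ : IsOpen O₀)
    {Ψ : (Fin (m + 1) → ℝ) → V} (hΨ : ContDiffOn ℝ ∞ Ψ O₀)
    (hΨinj : ∀ x ∈ O₀, Injective (fderiv ℝ Ψ x))
    {ℓ : V → (Fin (m + 1) → ℝ)} {Kℓ : ℝ≥0} (hℓ : LipschitzWith Kℓ ℓ) (hℓΨ : ∀ x ∈ O₀, ℓ (Ψ x) = x)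
    {f : V → ℝ} (hf : ContDiff ℝ ∞ f) {k₁ : Fin (m + 1) → ℝ} (hk₁ : k₁ ∈ O₀)
    (hdG : fderiv ℝ (f ∘ Ψ) k₁ ≠ 0) :
    ∃ O₁ : Set (Fin (m + 1) → ℝ), IsOpen O₁ ∧ k₁ ∈ O₁ ∧ O₁ ⊆ O₀ ∧
      ∀ C : Set (Fin (m + 1) → ℝ), MeasurableSet C → C ⊆ O₁ →
      ∀ θ : (Fin (m + 1) → ℝ) → ℤ, IntegrableOn (fun u => (θ u : ℝ)) C →
        ∃ D : ℝ → Current (⊤ : Opens V) m, (∀ᵐ t, (D t).IsRectifiable) ∧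
          ∀ φ : TestForm (⊤ : Opens V) m, ∀ᵐ s, Tendsto (fun n : ℕ =>
            ∫ u in C, (θ u : ℝ) * TestForm.wedgeD (contDiff_sliceApprox hf s (1 / ((n : ℝ) + 1))) φ
              (Ψ u) (fun l => fderiv ℝ Ψ u (Pi.single l 1))) atTop (𝓝 (D s φ)) := by
  classical
  /- `G = f ∘ Ψ`, a coordinate with `∂ᵢ G(k₁) ≠ 0`, the straightening `Φ` -/
  set G : (Fin (m + 1) → ℝ) → ℝ := f ∘ Ψ with hGdef
  have hG : ContDiffOn ℝ ∞ G O₀ := hf.comp_contDiffOn hΨ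
  obtain ⟨i, hi⟩ := exists_single_apply_ne_zero hdG
  obtain ⟨Φ, hΦO₀, hk₁Φ, hΦs, hGΦ, hΦj, hΦinj, σ, hσ, hdet⟩ := exists_straighten hO₀ hG hk₁ hi
  obtain ⟨L, hLy, hins, hLe, hLinj⟩ := exists_insertNth_clm' (m := m) i
  have hsrc : IsOpen Φ.source := Φ.open_source
  -- the composite chart `F = Ψ ∘ Φ` on `Φ.source`
  set F : (Fin (m + 1) → ℝ) → V := fun u => Ψ (Φ u) with hF
  have hΦmaps : MapsTo Φ Φ.source O₀ := fun u hu => hΦO₀ (Φ.map_source hu)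
  have hFs : ContDiffOn ℝ ∞ F Φ.source := hΨ.comp hΦs hΦmaps
  have hFd : ∀ u ∈ Φ.source, HasFDerivAt F (fderiv ℝ F u) u := fun u hu =>
    ((hFs.differentiableOn (by simp)) u hu).differentiableAt (hsrc.mem_nhds hu) |>.hasFDerivAt
  have hΨd : ∀ u ∈ O₀, DifferentiableAt ℝ Ψ u := fun u hu =>
    ((hΨ.differentiableOn (by simp)) u hu).differentiableAt (hO₀.mem_nhds hu)
  have hΦd : ∀ u ∈ Φ.source, HasFDerivAt Φ (fderiv ℝ Φ u) u := fun u hu =>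
    ((hΦs.differentiableOn (by simp)) u hu).differentiableAt (hsrc.mem_nhds hu) |>.hasFDerivAt
  have hFderiv : ∀ u ∈ Φ.source, fderiv ℝ F u = (fderiv ℝ Ψ (Φ u)).comp (fderiv ℝ Φ u) :=
    fun u hu => fderiv_comp u (hΨd _ (hΦmaps hu)) (hΦd u hu).differentiableAt
  have hFinj : ∀ u ∈ Φ.source, Injective (fderiv ℝ F u) := fun u hu => by
    rw [hFderiv u hu]
    exact (hΨinj _ (hΦmaps hu)).comp (hΦinj u hu)
  have hFcont : ContinuousOn (fderiv ℝ F) Φ.source := hFs.continuousOn_fderiv_of_isOpen hsrc (by simp)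
  have hΦcont : ContinuousOn Φ Φ.source := Φ.continuousOn
  have hΦfcont : ContinuousOn (fderiv ℝ Φ) Φ.source :=
    hΦs.continuousOn_fderiv_of_isOpen hsrc (by simp)
  -- derivatives of `G`, and `DG(Φ w) ∘ DΦ(w) = prᵢ`
  have hGΨ : ∀ u ∈ O₀, fderiv ℝ G u = (fderiv ℝ f (Ψ u)).comp (fderiv ℝ Ψ u) := fun u hu =>
    fderiv_comp u (hf.differentiable (by simp) _) (hΨd u hu)
  have hGd : ∀ u ∈ O₀, HasFDerivAt G (fderiv ℝ G u) u := fun u hu =>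
    ((hG.differentiableOn (by simp)) u hu).differentiableAt (hO₀.mem_nhds hu) |>.hasFDerivAt
  have hproj : ∀ w ∈ Φ.source, ∀ v, fderiv ℝ G (Φ w) (fderiv ℝ Φ w v) = v i := fun w hw v => by
    have h1 : HasFDerivAt (G ∘ Φ) ((fderiv ℝ G (Φ w)).comp (fderiv ℝ Φ w)) w :=
      (hGd _ (hΦmaps hw)).comp w (hΦd w hw)
    have heq : (G ∘ Φ) =ᶠ[𝓝 w] fun u : Fin (m + 1) → ℝ => u i := by
      filter_upwards [hsrc.mem_nhds hw] with u hu
      exact hGΦ u hu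
    have h2 : HasFDerivAt (G ∘ Φ) (ContinuousLinearMap.proj (R := ℝ) (φ := fun _ : Fin (m + 1) => ℝ) i) w :=
      (hasFDerivAt_apply i w).congr_of_eventuallyEq heq
    have := congrArg (fun T : (Fin (m + 1) → ℝ) →L[ℝ] ℝ => T v) (h1.unique h2)
    simpa using this
  /- a ball `B` around `u₁ = Φ⁻¹ k₁` with closure in the source; `Φ₁ = Φ|B`, `O₁ = Φ(B)` -/
  set u₁ := Φ.symm k₁ with hu₁
  have hu₁src : u₁ ∈ Φ.source := Φ.map_target hk₁Φ
  have hΦu₁ : Φ u₁ = k₁ := Φ.right_inv hk₁Φ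
  obtain ⟨r, hr, hrsrc⟩ : ∃ r > 0, closedBall u₁ r ⊆ Φ.source := by
    obtain ⟨r, hr, h⟩ := Metric.nhds_basis_closedBall.mem_iff.1 (hsrc.mem_nhds hu₁src)
    exact ⟨r, hr, h⟩
  set B : Set (Fin (m + 1) → ℝ) := ball u₁ r with hB
  have hBsrc : B ⊆ Φ.source := ball_subset_closedBall.trans hrsrc
  set Φ₁ := Φ.restrOpen B isOpen_ball with hΦ₁
  have hΦ₁src : Φ₁.source = B := by
    rw [hΦ₁, Φ.restrOpen_source]; exact inter_eq_right.2 hBsrc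
  set O₁ : Set (Fin (m + 1) → ℝ) := Φ₁.target with hO₁
  have hO₁o : IsOpen O₁ := Φ₁.open_target
  have hO₁sub : O₁ ⊆ Φ.target := fun x hx => by
    have := Φ₁.map_target hx
    rw [hΦ₁src] at this
    have h2 : Φ₁ (Φ₁.symm x) = x := Φ₁.right_inv hx
    rw [← h2]
    exact Φ.map_source (hBsrc this)
  have hO₁O₀ : O₁ ⊆ O₀ := hO₁sub.trans hΦO₀
  have hk₁O₁ : k₁ ∈ O₁ := by
    rw [← hΦu₁]
    exact Φ₁.map_source (by rw [hΦ₁src]; exact mem_ball_self hr)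
  -- bounds on the closed ball
  obtain ⟨CF, hCF⟩ : ∃ C, ∀ u ∈ closedBall u₁ r, ‖fderiv ℝ F u‖ ≤ C :=
    (isCompact_closedBall u₁ r).exists_bound_of_continuousOn (hFcont.mono hrsrc)
  have hCF0 : 0 ≤ CF := (norm_nonneg _).trans (hCF u₁ (mem_closedBall_self hr.le))
  have hFlip : LipschitzOnWith ⟨CF, hCF0⟩ F B :=
    (convex_ball u₁ r).lipschitzOnWith_of_nnnorm_fderiv_le
      (fun u hu => ((hFs.differentiableOn (by simp)) u (hBsrc hu)).differentiableAt
        (hsrc.mem_nhds (hBsrc hu)))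
      (fun u hu => by
        rw [← NNReal.coe_le_coe, coe_nnnorm]
        exact hCF u (ball_subset_closedBall hu))
  -- the Jacobian determinant: nonvanishing, bounded below on the closed ball
  have hdetne : ∀ w ∈ Φ.source, (fderiv ℝ Φ w).det ≠ 0 := fun w hw => by
    have h1 : IsUnit ((fderiv ℝ Φ w : (Fin (m + 1) → ℝ) →L[ℝ] (Fin (m + 1) → ℝ)) :
        (Fin (m + 1) → ℝ) →ₗ[ℝ] (Fin (m + 1) → ℝ)) :=
      (LinearMap.isUnit_iff_ker_eq_bot _).2 (LinearMap.ker_eq_bot.2 (hΦinj w hw))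
    exact ((LinearMap.isUnit_iff_isUnit_det _).1 h1).ne_zero
  have hdetcont : ContinuousOn (fun w => |(fderiv ℝ Φ w).det|) Φ.source :=
    (continuous_abs.comp ContinuousLinearMap.continuous_det).comp_continuousOn hΦfcont
  obtain ⟨δ, hδ, hδle⟩ : ∃ δ : ℝ, 0 < δ ∧ ∀ w ∈ closedBall u₁ r, δ ≤ |(fderiv ℝ Φ w).det| := by
    obtain ⟨w₀, hw₀, hmin⟩ := (isCompact_closedBall u₁ r).exists_isMinOn
      ⟨u₁, mem_closedBall_self hr.le⟩ (hdetcont.mono hrsrc)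
    exact ⟨_, abs_pos.2 (hdetne w₀ (hrsrc hw₀)), fun w hw => (isMinOn_iff.1 hmin) w hw⟩
  -- the fibre frame is continuous, hence bounded on the closed ball
  have hframe_cont : ContinuousOn (fun u => frameVector fun j =>
      fderiv ℝ F u (Pi.single (i.succAbove j) 1)) Φ.source := by
    refine (continuous_frameVector' (V := V) (n := m)).comp_continuousOn ?_
    refine continuousOn_pi.2 fun j => ?_
    exact (ContinuousLinearMap.apply ℝ V (Pi.single (i.succAbove j) 1)).continuous.comp_continuousOn
      hFcont
  obtain ⟨Cfr, hCfr⟩ : ∃ C, ∀ u ∈ closedBall u₁ r,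
      ‖frameVector fun j => fderiv ℝ F u (Pi.single (i.succAbove j) 1)‖ ≤ C :=
    (isCompact_closedBall u₁ r).exists_bound_of_continuousOn (hframe_cont.mono hrsrc)
  have hKc : IsCompact (F '' closedBall u₁ r) :=
    (isCompact_closedBall u₁ r).image_of_continuousOn (hFs.continuousOn.mono hrsrc)
  refine ⟨O₁, hO₁o, hk₁O₁, hO₁O₀, fun C hC hCO₁ θ hθ => ?_⟩
  /- the sign `c = σ (−1)ⁱ` -/
  obtain ⟨c, hc⟩ : ∃ c : ℤ, (c : ℝ) = σ * (-1 : ℝ) ^ (i : ℕ) := by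
    rcases hσ with h | h <;> rcases neg_one_pow_eq_or ℝ (i : ℕ) with h' | h'
    · exact ⟨1, by rw [h, h']; norm_num⟩
    · exact ⟨-1, by rw [h, h']; norm_num⟩
    · exact ⟨-1, by rw [h, h']; norm_num⟩
    · exact ⟨1, by rw [h, h']; norm_num⟩
  /- the pulled-back set `C' = B ∩ Φ⁻¹ C`, with `Φ(C') = C` -/
  set C' : Set (Fin (m + 1) → ℝ) := B ∩ Φ ⁻¹' C with hC'
  have hC'B : C' ⊆ B := inter_subset_left
  have hC'src : C' ⊆ Φ.source := hC'B.trans hBsrc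
  have hC'm : MeasurableSet C' := by
    have hcont : Continuous (B.restrict Φ) :=
      continuousOn_iff_continuous_restrict.1 (hΦcont.mono hBsrc)
    have h1 : MeasurableSet ((B.restrict Φ) ⁻¹' C) := hcont.measurable hC
    have h2 : C' = Subtype.val '' ((B.restrict Φ) ⁻¹' C) := by
      ext w
      simp only [hC', mem_inter_iff, mem_preimage, mem_image, Subtype.exists, restrict_apply,
        exists_and_right, exists_eq_right]
      constructor
      · rintro ⟨hwB, hwC⟩; exact ⟨hwB, hwC⟩
      · rintro ⟨hwB, hwC⟩; exact ⟨hwB, hwC⟩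
    rw [h2]
    exact MeasurableSet.subtype_image measurableSet_ball h1
  have hΦC' : Φ '' C' = C := by
    apply Subset.antisymm
    · rintro _ ⟨w, hw, rfl⟩; exact hw.2
    · intro x hx
      have hxO₁ := hCO₁ hx
      have hw : Φ₁.symm x ∈ B := by rw [← hΦ₁src]; exact Φ₁.map_target hxO₁
      have hΦw : Φ (Φ₁.symm x) = x := Φ₁.right_inv hxO₁
      exact ⟨Φ₁.symm x, ⟨hw, by rw [mem_preimage, hΦw]; exact hx⟩, hΦw⟩
  have hinjC' : InjOn Φ C' := Φ.injOn.mono hC'src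
  have hderivC' : ∀ w ∈ C', HasFDerivWithinAt Φ (fderiv ℝ Φ w) C' w := fun w hw =>
    (hΦd w (hC'src hw)).hasFDerivWithinAt
  /- `θ ∘ Φ` is integrable on `C'` (change of variables, `|det DΦ| ≥ δ`) -/
  set θΦ : (Fin (m + 1) → ℝ) → ℝ := fun w => (θ (Φ w) : ℝ) with hθΦ
  have hθΦint : IntegrableOn θΦ C' := by
    have h1 : IntegrableOn (fun w => |(fderiv ℝ Φ w).det| • (θ (Φ w) : ℝ)) C' := by
      have := (integrableOn_image_iff_integrableOn_abs_det_fderiv_smul volume hC'm hderivC'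
        hinjC' (fun u => (θ u : ℝ))).1 (by rw [hΦC']; exact hθ)
      exact this
    have h2 : IntegrableOn (fun w => |(fderiv ℝ Φ w).det|⁻¹ *
        (|(fderiv ℝ Φ w).det| • (θ (Φ w) : ℝ))) C' := by
      refine h1.bdd_mul (c := δ⁻¹) ?_ ?_
      · exact ((hdetcont.mono hC'src).inv₀ fun w hw =>
          (abs_pos.2 (hdetne w (hC'src hw))).ne').aestronglyMeasurable hC'm
      · filter_upwards [ae_restrict_mem hC'm] with w hw
        rw [norm_inv, Real.norm_eq_abs, abs_abs]
        exact inv_anti₀ hδ (hδle w (ball_subset_closedBall (hC'B hw)))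
    refine h2.congr_fun (fun w hw => ?_) hC'm
    have hne : |(fderiv ℝ Φ w).det| ≠ 0 := (abs_pos.2 (hdetne w (hC'src hw))).ne'
    simp only [hθΦ, smul_eq_mul]
    rw [← mul_assoc, inv_mul_cancel₀ hne, one_mul]
  /- the fibre parametrisations `γ_t(z) = F(insᵢ t z)` over `EuclideanSpace ℝ (Fin m)` -/
  set Mo : EuclideanSpace ℝ (Fin m) →L[ℝ] (Fin (m + 1) → ℝ) :=
    L.comp (PiLp.continuousLinearEquiv 2 ℝ (fun _ : Fin m => ℝ) :
      EuclideanSpace ℝ (Fin m) →L[ℝ] (Fin m → ℝ)) with hMo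
  set ι : ℝ → EuclideanSpace ℝ (Fin m) → (Fin (m + 1) → ℝ) := fun t z => i.insertNth t (ofLp z)
    with hι
  have hιeq : ∀ t z, ι t z = (Pi.single i t : Fin (m + 1) → ℝ) + Mo z := fun t z => by
    simp only [hι, hMo, ContinuousLinearMap.comp_apply]
    rw [hins t (ofLp z)]
    rfl
  have hιd : ∀ t z, HasFDerivAt (ι t) Mo z := fun t z => by
    have : ι t = fun z => (Pi.single i t : Fin (m + 1) → ℝ) + Mo z := funext (hιeq t)
    rw [this]
    exact (Mo.hasFDerivAt).const_add _
  have hιcont : ∀ t, Continuous (ι t) := fun t => by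
    rw [show ι t = fun z => (Pi.single i t : Fin (m + 1) → ℝ) + Mo z from funext (hιeq t)]
    exact continuous_const.add Mo.continuous
  have hιj : ∀ t z j, ι t z (i.succAbove j) = ofLp z j := fun t z j => by simp [hι]
  have hMoe : ∀ j, Mo (EuclideanSpace.basisFun (Fin m) ℝ j) = Pi.single (i.succAbove j) 1 := by
    intro j
    simp only [hMo, ContinuousLinearMap.comp_apply]
    rw [EuclideanSpace.basisFun_apply, ← hLe j]
    rfl
  have hιlip : ∀ t, LipschitzWith ‖Mo‖₊ (ι t) := fun t => by
    rw [show ι t = fun z => (Pi.single i t : Fin (m + 1) → ℝ) + Mo z from funext (hιeq t)]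
    exact LipschitzWith.of_dist_le_mul fun z z' => by
      rw [dist_add_left]; exact Mo.lipschitz.dist_le_mul z z'
  set sE : ℝ → Set (EuclideanSpace ℝ (Fin m)) := fun t => ι t ⁻¹' C' with hsE
  have hsEm : ∀ t, MeasurableSet (sE t) := fun t => (hιcont t).measurable hC'm
  have hsEB : ∀ t, sE t ⊆ ι t ⁻¹' B := fun t => preimage_mono hC'B
  set γ : ℝ → EuclideanSpace ℝ (Fin m) → V := fun t z => F (ι t z) with hγ
  set γ' : ℝ → EuclideanSpace ℝ (Fin m) → EuclideanSpace ℝ (Fin m) →L[ℝ] V :=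
    fun t z => (fderiv ℝ F (ι t z)).comp Mo with hγ'
  have hγd : ∀ t, ∀ z ∈ sE t, HasFDerivWithinAt (γ t) (γ' t z) (sE t) z := fun t z hz =>
    ((hFd (ι t z) (hBsrc (hsEB t hz))).comp z (hιd t z)).hasFDerivWithinAt
  have hγ'inj : ∀ t, ∀ z ∈ sE t, Injective (γ' t z) := fun t z hz =>
    (hFinj (ι t z) (hBsrc (hsEB t hz))).comp
      (hLinj.comp (PiLp.continuousLinearEquiv 2 ℝ _).injective)
  -- the left inverse `z = toLp ((ℓ (γ z)) ∘ succAbove i)`: anti-Lipschitz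
  set Rι : V → EuclideanSpace ℝ (Fin m) := fun v => toLp 2 (fun j => ℓ v (i.succAbove j)) with hRι
  obtain ⟨KR, hRlip⟩ : ∃ KR, LipschitzWith KR Rι := by
    have h1 : LipschitzWith 1 (fun y : Fin (m + 1) → ℝ => fun j => y (i.succAbove j)) :=
      LipschitzWith.of_dist_le_mul fun y y' => by
        rw [NNReal.coe_one, one_mul, dist_pi_le_iff dist_nonneg]
        exact fun j => dist_le_pi_dist y y' (i.succAbove j)
    exact ⟨_, ((PiLp.lipschitzWith_toLp 2 (fun _ : Fin m => ℝ)).comp h1).comp hℓ⟩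
  have hRγ : ∀ t, ∀ z ∈ ι t ⁻¹' B, Rι (γ t z) = z := fun t z hz => by
    have h1 : ℓ (γ t z) = Φ (ι t z) := hℓΨ _ (hΦmaps (hBsrc hz))
    simp only [hRι, h1]
    have h2 : (fun j => Φ (ι t z) (i.succAbove j)) = ofLp z := by
      ext j; rw [hΦj _ (hBsrc hz), hιj]
    rw [h2, toLp_ofLp]
  have hγanti : ∀ t, AntilipschitzWith KR ((sE t).restrict (γ t)) := fun t =>
    AntilipschitzWith.of_le_mul_dist fun z z' => by
      have := hRlip.dist_le_mul (γ t z) (γ t z')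
      rw [hRγ t z (hsEB t z.2), hRγ t z' (hsEB t z'.2)] at this
      exact this
  have hγinj : ∀ t, InjOn (γ t) (sE t) := fun t z hz z' hz' h => by
    rw [← hRγ t z (hsEB t hz), ← hRγ t z' (hsEB t hz'), h]
  have hγlip : ∀ t, LipschitzOnWith (⟨CF, hCF0⟩ * ‖Mo‖₊) (γ t) (sE t) := fun t =>
    hFlip.comp (hιlip t).lipschitzOnWith fun z hz => hsEB t hz
  set e := EuclideanSpace.basisFun (Fin m) ℝ with he
  have hγ'e : ∀ t z j, γ' t z (e j) = fderiv ℝ F (ι t z) (Pi.single (i.succAbove j) 1) :=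
    fun t z j => by
    simp only [hγ', ContinuousLinearMap.comp_apply, he]
    rw [hMoe j]
  have hγK : ∀ t, γ t '' sE t ⊆ F '' closedBall u₁ r := fun t => by
    rintro _ ⟨z, hz, rfl⟩; exact ⟨ι t z, ball_subset_closedBall (hsEB t hz), rfl⟩
  /- the densities `θ'_t = c · θ ∘ Φ ∘ ι_t` and the level currents `D t` -/
  set θ' : ℝ → EuclideanSpace ℝ (Fin m) → ℤ := fun t z => c * θ (Φ (ι t z)) with hθ'
  set D : ℝ → Current (⊤ : Opens V) m := fun t =>
    currentOfIntegration (γ t '' sE t) (imageDensity (γ t) (sE t) (θ' t))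
      (imageFrame (γ t) (γ' t) (sE t) e) with hD
  -- integrability of the parameter-side density from that of `θ ∘ Φ ∘ ι_t`
  have hint_of : ∀ t, IntegrableOn (fun z => θΦ (ι t z)) (sE t) →
      IntegrableOn (fun z => (θ' t z : ℝ) • frameVector fun j => γ' t z (e j)) (sE t) :=
    fun t ht => by
    have hfv : ContinuousOn (fun z => frameVector fun j => γ' t z (e j)) (sE t) := by
      have : (fun z => frameVector fun j => γ' t z (e j)) =
          fun z => frameVector fun j => fderiv ℝ F (ι t z) (Pi.single (i.succAbove j) 1) := by
        funext z; simp only [hγ'e]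
      rw [this]
      exact hframe_cont.comp (hιcont t).continuousOn fun z hz => hBsrc (hsEB t hz)
    have hsc : IntegrableOn (fun z => (c : ℝ) * θΦ (ι t z)) (sE t) := ht.const_mul _
    refine Integrable.mono' (hsc.norm.mul_const Cfr)
      ((hsc.aestronglyMeasurable.congr ?_).smul (hfv.aestronglyMeasurable (hsEm t))) ?_
    · exact Eventually.of_forall fun z => by simp [hθ', hθΦ]
    · filter_upwards [ae_restrict_mem (hsEm t)] with z hz
      rw [norm_smul]
      refine mul_le_mul ?_ ?_ (norm_nonneg _) (norm_nonneg _)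
      · simp [hθ', hθΦ]
      · have := hCfr (ι t z) (ball_subset_closedBall (hsEB t hz))
        simpa only [hγ'e] using this
  -- rectifiability of `D t` for such `t`
  have hrect_of : ∀ t, IntegrableOn (fun z => θΦ (ι t z)) (sE t) → (D t).IsRectifiable :=
    fun t ht => by
    have hdata := isRectifiableData_image_density (hsEm t) (hγd t) (hγ'inj t) (hγanti t)
      (hγlip t) (hint_of t ht) (Ω := (⊤ : Opens V)) (fun _ _ => trivial)
    refine ⟨⟨_, _, _, hdata, rfl⟩, ?_⟩
    refine Current.isCompact_support_of_subset _ hKc (fun _ _ => trivial) ?_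
    exact (support_currentOfIntegration_subset_closure _ _ _).trans
      (closure_minimal (hγK t) hKc.isClosed)
  -- a.e. fibre integrability of `θ ∘ Φ` (Fubini), hence `D t ∈ 𝓡_m(V)` for a.e. `t`
  have hθind : Integrable (C'.indicator θΦ) := hθΦint.integrable_indicator hC'm
  have hfib : ∀ᵐ t, IntegrableOn (fun z => θΦ (ι t z)) (sE t) := by
    have h1 := (integral_mul_apply_eq_integral_integral_insertNth i hθind
      (κ := fun _ => (1 : ℝ)) continuous_const (M := 1) (fun _ => by simp)).2.2
    filter_upwards [h1] with t ht
    have h2 : Integrable (fun z : EuclideanSpace ℝ (Fin m) => C'.indicator θΦ (ι t z)) :=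
      ((PiLp.volume_preserving_ofLp (Fin m)).integrable_comp ht.aestronglyMeasurable).2 ht
    have h3 : (fun z : EuclideanSpace ℝ (Fin m) => C'.indicator θΦ (ι t z)) =
        (sE t).indicator (fun z => θΦ (ι t z)) := by
      funext z
      exact (indicator_comp_right (ι t) (g := θΦ) (s := C')).symm
    rw [h3] at h2
    exact (integrable_indicator_iff (hsEm t)).1 h2
  have hDrect : ∀ᵐ t, (D t).IsRectifiable := hfib.mono fun t ht => hrect_of t ht
  refine ⟨D, hDrect, fun φ => ?_⟩
  /- Now fix the test form `φ`: the fibre integrand `K_φ` and the fibre integrals `Γ_φ` -/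
  have hev_cont : ContinuousOn (fun w => φ (F w)
      (fun j => fderiv ℝ F w (Pi.single (i.succAbove j) 1))) Φ.source := by
    have h1 : ContinuousOn (fun w => (⇑φ (F w),
        fun j => fderiv ℝ F w (Pi.single (i.succAbove j) 1))) Φ.source := by
      refine ContinuousOn.prodMk (φ.contDiff.continuous.comp_continuousOn hFs.continuousOn) ?_
      refine continuousOn_pi.2 fun j => ?_
      exact (ContinuousLinearMap.apply ℝ V (Pi.single (i.succAbove j) 1)).continuous.comp_continuousOn
        hFcont
    exact continuous_eval.comp_continuousOn h1
  obtain ⟨Cev, hCev⟩ : ∃ C, ∀ w ∈ closedBall u₁ r,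
      ‖φ (F w) (fun j => fderiv ℝ F w (Pi.single (i.succAbove j) 1))‖ ≤ C :=
    (isCompact_closedBall u₁ r).exists_bound_of_continuousOn (hev_cont.mono hrsrc)
  set Kφ : (Fin (m + 1) → ℝ) → ℝ := fun w =>
    φ (F w) (fun j => fderiv ℝ F w (Pi.single (i.succAbove j) 1)) * ((c : ℝ) * θΦ w) with hKφ
  have hKint : IntegrableOn Kφ C' :=
    (hθΦint.const_mul (c : ℝ)).bdd_mul (c := Cev) ((hev_cont.mono hC'src).aestronglyMeasurable hC'm)
      ((ae_restrict_mem hC'm).mono fun w hw => hCev w (ball_subset_closedBall (hC'B hw)))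
  set Kind : (Fin (m + 1) → ℝ) → ℝ := C'.indicator Kφ with hKind
  have hKind : Integrable Kind := hKint.integrable_indicator hC'm
  set Γ : ℝ → ℝ := fun t => ∫ y, Kind (i.insertNth t y) with hΓ
  have hΓint : Integrable Γ :=
    (integral_mul_apply_eq_integral_integral_insertNth i hKind (κ := fun _ => (1 : ℝ))
      continuous_const (M := 1) (fun _ => by simp)).2.1
  /- (a) `∫_C θ (dg ∧ φ)(Ψ u)(DΨ e) du = ∫ ρ(t) Γ(t) dt` for every kernel `ρ = (S(h⁻¹(· − s)))'` -/
  have hident : ∀ s h : ℝ, 0 < h →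
      ∫ u in C, (θ u : ℝ) * TestForm.wedgeD (contDiff_sliceApprox hf s h) φ (Ψ u)
          (fun l => fderiv ℝ Ψ u (Pi.single l 1)) =
        ∫ t, deriv (sliceApprox id s h) t * Γ t := by
    intro s h hh
    set ρ := deriv (sliceApprox id s h) with hρ
    have hρc : Continuous ρ := continuous_deriv_sliceApprox_id s h
    have hρb : ∀ t, ‖ρ t‖ ≤ smoothTransitionDerivBound / h := fun t => by
      rw [Real.norm_eq_abs]
      refine (abs_deriv_sliceApprox_id_le hh t).trans ?_
      have : (Icc s (s + h)).indicator (1 : ℝ → ℝ) t ≤ 1 :=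
        indicator_le_self' (fun _ _ => zero_le_one) t
      have h0 : 0 ≤ smoothTransitionDerivBound / h :=
        div_nonneg smoothTransitionDerivBound_nonneg hh.le
      nlinarith
    -- the integrand on `O₀`
    have hW : ∀ u ∈ O₀, TestForm.wedgeD (contDiff_sliceApprox hf s h) φ (Ψ u)
        (fun l => fderiv ℝ Ψ u (Pi.single l 1)) =
        ρ (f (Ψ u)) * ∑ l : Fin (m + 1), (-1 : ℝ) ^ (l : ℕ) * (fderiv ℝ G u (Pi.single l 1) *
          φ (Ψ u) (fun j => fderiv ℝ Ψ u (Pi.single (l.succAbove j) 1))) := fun u hu => by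
      rw [TestForm.wedgeD_apply_apply, Finset.mul_sum]
      refine Finset.sum_congr rfl fun l _ => ?_
      rw [fderiv_sliceApprox_eq_deriv_smul (hf.differentiable (by simp) _), hGΨ u hu,
        FunLike.coe_smul, Pi.smul_apply, ContinuousLinearMap.comp_apply, smul_eq_mul]
      have hrm : l.removeNth (fun l => fderiv ℝ Ψ u (Pi.single l 1)) =
          fun j => fderiv ℝ Ψ u (Pi.single (l.succAbove j) 1) := rfl
      rw [hrm]
      ring
    -- change of variables `u = Φ w` on `C = Φ(C')`
    have hcv := integral_image_eq_integral_abs_det_fderiv_smul volume hC'm hderivC' hinjC'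
      (fun u => (θ u : ℝ) * TestForm.wedgeD (contDiff_sliceApprox hf s h) φ (Ψ u)
        (fun l => fderiv ℝ Ψ u (Pi.single l 1)))
    rw [hΦC'] at hcv
    rw [hcv]
    -- pointwise on `C'`: `|det DΦ(w)| θ(Φ w) (dg ∧ φ)(Ψ Φ w)(DΨ e) = ρ(wᵢ) K_φ(w)`
    have hpt : ∀ w ∈ C', |(fderiv ℝ Φ w).det| • ((θ (Φ w) : ℝ) *
        TestForm.wedgeD (contDiff_sliceApprox hf s h) φ (Ψ (Φ w))
          (fun l => fderiv ℝ Ψ (Φ w) (Pi.single l 1))) = ρ (w i) * Kφ w := fun w hw => by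
      have hws : w ∈ Φ.source := hC'src hw
      have hΦw : Φ w ∈ O₀ := hΦmaps hws
      have hkey := det_mul_sum_wedge_eq (i := i)
        ((φ (Ψ (Φ w))).compContinuousLinearMap (fderiv ℝ Ψ (Φ w))) (fderiv ℝ G (Φ w))
        (fderiv ℝ Φ w) (hproj w hws)
      simp only [ContinuousAlternatingMap.compContinuousLinearMap_apply, Function.comp_def] at hkey
      have hFw : ∀ j, fderiv ℝ Ψ (Φ w) (fderiv ℝ Φ w (Pi.single (i.succAbove j) 1)) =
          fderiv ℝ F w (Pi.single (i.succAbove j) 1) := fun j => by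
        rw [hFderiv w hws, ContinuousLinearMap.comp_apply]
      simp only [hFw] at hkey
      have hFw0 : Ψ (Φ w) = F w := rfl
      rw [hFw0] at hkey
      have hGw : f (F w) = w i := hGΦ w hws
      rw [hW _ hΦw, hdet w hws, smul_eq_mul, hFw0, hGw]
      simp only [hKφ, hθΦ]
      rw [hc]
      linear_combination (σ * (θ (Φ w) : ℝ) * ρ (w i)) * hkey
    rw [setIntegral_congr_fun hC'm hpt, ← integral_indicator hC'm]
    have hind : (C'.indicator fun w => ρ (w i) * Kφ w) = fun w => ρ (w i) * Kind w := by
      funext w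
      exact indicator_mul_right C' (fun w => ρ (w i)) Kφ
    rw [hind]
    exact (integral_mul_apply_eq_integral_integral_insertNth i hKind hρc hρb).1
  /- (b) `Γ(s) = D_s(φ)` for a.e. `s` -/
  have hΓD : ∀ᵐ s, Γ s = D s φ := by
    filter_upwards [hfib] with t ht
    have hint := hint_of t ht
    have hDt : D t φ = currentOfIntegration (γ t '' sE t) (imageDensity (γ t) (sE t) (θ' t))
        (imageFrame (γ t) (γ' t) (sE t) e) φ := rfl
    rw [hDt, currentOfIntegration_image_density_apply (hsEm t) (hγd t) (hγ'inj t) (hγinj t) e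
      hint]
    have hemb : MeasurableEmbedding (@ofLp 2 (Fin m → ℝ)) := by
      rw [← MeasurableEquiv.coe_toLp_symm]
      exact (MeasurableEquiv.toLp 2 (Fin m → ℝ)).symm.measurableEmbedding
    set Y : Set (Fin m → ℝ) := (fun y => i.insertNth t y) ⁻¹' C' with hY
    have hYm : MeasurableSet Y :=
      (Continuous.finInsertNth i continuous_const continuous_id).measurable hC'm
    have h1 : Γ t = ∫ y in Y, Kφ (i.insertNth t y) := by
      simp only [hΓ]
      rw [← integral_indicator hYm]
      refine integral_congr_ae (Eventually.of_forall fun y => ?_)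
      exact (indicator_comp_right (fun y => i.insertNth t y) (g := Kφ) (s := C')).symm
    have h2 := (PiLp.volume_preserving_ofLp (Fin m)).setIntegral_preimage_emb hemb
      (fun y => Kφ (i.insertNth t y)) Y
    have hsEY : sE t = (@ofLp 2 (Fin m → ℝ)) ⁻¹' Y := by
      ext z; simp only [hsE, hY, mem_preimage, hι]
    rw [h1, ← h2, ← hsEY]
    refine setIntegral_congr_fun (hsEm t) fun z _ => ?_
    simp only [hKφ, hθΦ, hθ', hγ'e, hγ, hι, Int.cast_mul]
    ring
  /- (c) conclusion: Lebesgue points of `Γ` -/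
  have hL := ae_tendsto_integral_deriv_sliceApprox_mul hΓint
  filter_upwards [hL, hΓD] with s hs hsD
  rw [← hsD]
  exact hs.congr fun n => (hident s (1 / ((n : ℝ) + 1)) (by positivity)).symm

/-- **Slicing on a compact set of regular points.** In the setting of `exists_sliceData_chart`,
if `K ⊆ O₀` is compact and `d(f ∘ Ψ) ≠ 0` on `K`, then for every measurable `C ⊆ K` and every
integer density `θ` integrable on `C` there are currents `D_t`, rectifiable for a.e. `t`, with
`∫_C θ (d gₙ ∧ φ)(Ψ u)(DΨ(u) e) du → D_s(φ)` for every test form `φ` and a.e. `s` (a finite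
subcover by the neighbourhoods of `exists_sliceData_chart`, disjointified; the level currents
add up). [cite: Federer1969, 4.3.8, 3.2.22] -/
theorem exists_sliceData_compact {O₀ : Set (Fin (m + 1) → ℝ)} (hO₀ : IsOpen O₀)
    {Ψ : (Fin (m + 1) → ℝ) → V} (hΨ : ContDiffOn ℝ ∞ Ψ O₀)
    (hΨinj : ∀ x ∈ O₀, Injective (fderiv ℝ Ψ x))
    {ℓ : V → (Fin (m + 1) → ℝ)} {Kℓ : ℝ≥0} (hℓ : LipschitzWith Kℓ ℓ) (hℓΨ : ∀ x ∈ O₀, ℓ (Ψ x) = x)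
    {f : V → ℝ} (hf : ContDiff ℝ ∞ f) {K : Set (Fin (m + 1) → ℝ)} (hK : IsCompact K)
    (hKO₀ : K ⊆ O₀) (hdG : ∀ u ∈ K, fderiv ℝ (f ∘ Ψ) u ≠ 0)
    {C : Set (Fin (m + 1) → ℝ)} (hC : MeasurableSet C) (hCK : C ⊆ K)
    {θ : (Fin (m + 1) → ℝ) → ℤ} (hθ : IntegrableOn (fun u => (θ u : ℝ)) C) :
    ∃ D : ℝ → Current (⊤ : Opens V) m, (∀ᵐ t, (D t).IsRectifiable) ∧
      ∀ φ : TestForm (⊤ : Opens V) m, ∀ᵐ s, Tendsto (fun n : ℕ =>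
        ∫ u in C, (θ u : ℝ) * TestForm.wedgeD (contDiff_sliceApprox hf s (1 / ((n : ℝ) + 1))) φ
          (Ψ u) (fun l => fderiv ℝ Ψ u (Pi.single l 1))) atTop (𝓝 (D s φ)) := by
  classical
  -- local data at every point of `K`, and a finite subcover
  choose O₁ hO₁o hmem hO₁O₀ hloc using fun u : K =>
    exists_sliceData_chart hO₀ hΨ hΨinj hℓ hℓΨ hf (hKO₀ u.2) (hdG u u.2)
  obtain ⟨t, ht⟩ := hK.elim_finite_subcover O₁ hO₁o fun u hu => mem_iUnion.2 ⟨⟨u, hu⟩, hmem _⟩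
  set N := t.card with hN
  set v : Fin N → K := fun a => (t.equivFin.symm a).1 with hv
  set U : Fin N → Set (Fin (m + 1) → ℝ) := fun a => O₁ (v a) with hU
  have hUo : ∀ a, IsOpen (U a) := fun a => hO₁o _
  have hKU : K ⊆ ⋃ a, U a := fun x hx => by
    obtain ⟨u, hu⟩ := mem_iUnion.1 (ht hx)
    obtain ⟨hut, hxu⟩ := mem_iUnion.1 hu
    refine mem_iUnion.2 ⟨t.equivFin ⟨u, hut⟩, ?_⟩
    simp only [hU, hv, Equiv.symm_apply_apply]
    exact hxu
  -- disjointified pieces `P a = C ∩ U a ∖ ⋃_{b < a} U b`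
  set P : Fin N → Set (Fin (m + 1) → ℝ) := fun a => (C ∩ U a) \ ⋃ b, ⋃ (_ : b < a), U b with hP
  have hPm : ∀ a, MeasurableSet (P a) := fun a =>
    (hC.inter (hUo a).measurableSet).diff
      (MeasurableSet.iUnion fun b => MeasurableSet.iUnion fun _ => (hUo b).measurableSet)
  have hPU : ∀ a, P a ⊆ U a := fun a x hx => hx.1.2
  have hPC : ∀ a, P a ⊆ C := fun a x hx => hx.1.1
  have hPdisj : Pairwise (Disjoint on P) := fun a b hab => by
    rcases lt_or_gt_of_ne hab with h | h
    · exact disjoint_left.2 fun x hxa hxb => hxb.2 (mem_iUnion₂.2 ⟨a, h, hxa.1.2⟩)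
    · exact disjoint_left.2 fun x hxa hxb => hxa.2 (mem_iUnion₂.2 ⟨b, h, hxb.1.2⟩)
  have hPunion : (⋃ a, P a) = C := by
    refine Subset.antisymm (iUnion_subset hPC) fun x hx => ?_
    have hne : (Finset.univ.filter fun a => x ∈ U a).Nonempty := by
      obtain ⟨a, ha⟩ := mem_iUnion.1 (hKU (hCK hx))
      exact ⟨a, Finset.mem_filter.2 ⟨Finset.mem_univ _, ha⟩⟩
    set a₀ := (Finset.univ.filter fun a => x ∈ U a).min' hne with ha₀
    have ha₀mem : x ∈ U a₀ := (Finset.mem_filter.1 (Finset.min'_mem _ hne)).2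
    refine mem_iUnion.2 ⟨a₀, ⟨hx, ha₀mem⟩, fun hx' => ?_⟩
    obtain ⟨b, hb, hxb⟩ := mem_iUnion₂.1 hx'
    have := Finset.min'_le (Finset.univ.filter fun a => x ∈ U a) b
      (Finset.mem_filter.2 ⟨Finset.mem_univ b, hxb⟩)
    exact absurd hb (not_lt.2 this)
  -- the level currents of the pieces
  choose D hDr hDc using fun a => hloc (v a) (P a) (hPm a) (hPU a) θ (hθ.mono_set (hPC a))
  refine ⟨fun t => ∑ a, D a t, ?_, fun φ => ?_⟩
  · filter_upwards [ae_all_iff.2 hDr] with t ht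
    exact Finset.sum_induction _ (fun T : Current (⊤ : Opens V) m => T.IsRectifiable)
      (fun _ _ ha hb => ha.add_top hb) Current.isRectifiable_zero (fun a _ => ht a)
  · -- the integrand is integrable on `C` (bounded smooth factor on the compact `K`)
    have hint : ∀ (s h : ℝ), IntegrableOn (fun u => (θ u : ℝ) *
        TestForm.wedgeD (contDiff_sliceApprox hf s h) φ (Ψ u)
          (fun l => fderiv ℝ Ψ u (Pi.single l 1))) C := fun s h => by
      set W : (Fin (m + 1) → ℝ) → ℝ := fun u => TestForm.wedgeD (contDiff_sliceApprox hf s h) φ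
        (Ψ u) (fun l => fderiv ℝ Ψ u (Pi.single l 1)) with hW
      have hWc : ContinuousOn W O₀ := by
        have h1 : ContinuousOn (fun u => (⇑(TestForm.wedgeD (contDiff_sliceApprox hf s h) φ) (Ψ u),
            fun l => fderiv ℝ Ψ u (Pi.single l 1))) O₀ := by
          refine ContinuousOn.prodMk ((TestForm.wedgeD (contDiff_sliceApprox hf s h) φ).contDiff.continuous.comp_continuousOn
            hΨ.continuousOn) ?_
          refine continuousOn_pi.2 fun l => ?_
          exact (ContinuousLinearMap.apply ℝ V (Pi.single l 1)).continuous.comp_continuousOn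
            (hΨ.continuousOn_fderiv_of_isOpen hO₀ (by simp))
        exact continuous_eval.comp_continuousOn h1
      obtain ⟨CW, hCW⟩ : ∃ C, ∀ u ∈ K, ‖W u‖ ≤ C :=
        hK.exists_bound_of_continuousOn (hWc.mono hKO₀)
      have := hθ.bdd_mul (c := CW) ((hWc.mono (hCK.trans hKO₀)).aestronglyMeasurable hC)
        ((ae_restrict_mem hC).mono fun u hu => hCW u (hCK hu))
      exact IntegrableOn.congr_fun this (fun u _ => mul_comm _ _) hC
    filter_upwards [ae_all_iff.2 fun a => hDc a φ] with s hs
    set I : ℕ → (Fin (m + 1) → ℝ) → ℝ := fun n u => (θ u : ℝ) *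
      TestForm.wedgeD (contDiff_sliceApprox hf s (1 / ((n : ℝ) + 1))) φ (Ψ u)
        (fun l => fderiv ℝ Ψ u (Pi.single l 1)) with hI
    have hs' : ∀ a, Tendsto (fun n : ℕ => ∫ u in P a, I n u) atTop (𝓝 (D a s φ)) := hs
    have hsum : ∀ n : ℕ, ∫ u in C, I n u = ∑ a, ∫ u in P a, I n u := fun n => by
      have hIn : IntegrableOn (I n) (⋃ a, P a) := by rw [hPunion]; exact hint s _
      have h1 := integral_iUnion hPm hPdisj hIn
      rw [hPunion] at h1
      rw [h1, tsum_fintype]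
    have hlim : (∑ a, D a s) φ = ∑ a, D a s φ := by
      simp only [FunLike.coe_sum, Finset.sum_apply]
    change Tendsto (fun n : ℕ => ∫ u in C, I n u) atTop (𝓝 ((∑ a, D a s) φ))
    rw [show (fun n : ℕ => ∫ u in C, I n u) = fun n : ℕ => ∑ a, ∫ u in P a, I n u from
      funext hsum, hlim]
    exact tendsto_finsetSum _ fun a _ => hs' a

end Main

end Literature.Geometry.GeometricMeasureTheory
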